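import Mathlib
import Summits.Ventures.PercRepro2.CoinOrTailKDefs
import Summits.Ventures.PercRepro2.CoinKSureCoinsAlg
import Summits.Ventures.PercRepro2.CoinKSureTransport

/-!
# A ONE-ENTRY OR-tail extension of a log-supermodular core is log-supermodular
(blind cell PercRepro2, night-2 g16; proofs/NIGHT2-DARC.md §56.1)

`OrTailK arcs s U {r} c a'`: the vertex `a'` is entered only by the single-arc coin `c r = {(r, a')}`
from `r ∈ U`.  The cluster law of `insert a' U` is the cluster law of `U` times the coin factor
`ρ·1[r ∈ W]` / `1 − ρ·1[r ∈ W]` (`prob_coreLevel_eq`, `prob_tailEventK`), and the coin factor is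
log-supermodular (`extLaw_lsm`): so `insert a' U` is log-supermodular whenever `U` is.  Hence the
OR-tail theorems of the row (`darc_of_orTailK_coins_any`, …) apply over cores built from any
log-supermodular core by attaching one-entry OR-vertices — in particular the CHAIN `a' → a`
(§56) with a SINGLE `a'`-entry is a theorem for every lsm core (`darc_of_orTailK_oneChain`),
the free-arc vertex `a` being an OR-tail of `insert a' U` with the entries `ent ∪ {a'}` and
arbitrary coins.
-/

namespace Summit.Ventures.PercRepro2.Coin

open Classical

section OneEntry

variable {V : Type*} {E : Type*} [Fintype V] [DecidableEq V] [Fintype E] [DecidableEq E]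
  {R : Type*} [Field R] [LinearOrder R] [IsStrictOrderedRing R]
  {arcs : E → Finset (V × V)} {s : V} {U : Finset V} {r : V} {c : V → E} {a' : V}

omit [Fintype V] [LinearOrder R] [IsStrictOrderedRing R] in
/-- The cluster law of a one-entry extension is the cluster law of the core times the coin
factor of the entry. -/
lemma OrTailK.prob_coreLevel_one (h : OrTailK arcs s U {r} c a') (pr : E → R) (W : Finset V) :
    prob pr (coreLevel arcs s (insert a' U) W) =
      prob pr (coreLevel arcs s U (W ∩ U)) *
        (if a' ∈ W then (if r ∈ W then pr (c r) else 0)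
          else (if r ∈ W then 1 - pr (c r) else 1)) := by
  rw [h.prob_coreLevel_eq pr W, h.prob_tailEventK pr W]
  congr 1
  have htw : tailWtK pr {r} c W = 1 - pr (c r) * (if r ∈ W then 1 else 0) := by
    unfold tailWtK
    rw [Finset.prod_singleton]
  rw [htw]
  split_ifs <;> ring

omit [Fintype V] in
/-- **A one-entry OR-tail extension of a log-supermodular core is log-supermodular.** -/
theorem OrTailK.coreLevel_lsm_insert (h : OrTailK arcs s U {r} c a') (pr : E → R)
    (hp : IsProbVec pr)
    (hν : ∀ W W', W ⊆ U → W' ⊆ U →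
      prob pr (coreLevel arcs s U W) * prob pr (coreLevel arcs s U W') ≤
        prob pr (coreLevel arcs s U (W ∩ W')) * prob pr (coreLevel arcs s U (W ∪ W'))) :
    ∀ W W', W ⊆ insert a' U → W' ⊆ insert a' U →
      prob pr (coreLevel arcs s (insert a' U) W) * prob pr (coreLevel arcs s (insert a' U) W') ≤
        prob pr (coreLevel arcs s (insert a' U) (W ∩ W')) *
          prob pr (coreLevel arcs s (insert a' U) (W ∪ W')) := by
  intro W W' hW hW'
  rw [h.prob_coreLevel_one pr W, h.prob_coreLevel_one pr W', h.prob_coreLevel_one pr (W ∩ W'),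
    h.prob_coreLevel_one pr (W ∪ W')]
  exact extLaw_lsm U (fun X => prob pr (coreLevel arcs s U X)) r a' (pr (c r)) (hp.nonneg _)
    (hp.le_one _) (fun X => prob_nonneg hp _) (fun X hX Y hY => hν X Y hX hY) W hW W' hW'

end OneEntry

section OneChain

variable {V : Type*} {E : Type*} [Fintype V] [DecidableEq V] [Fintype E] [DecidableEq E]
  {R : Type*} [Field R] [LinearOrder R] [IsStrictOrderedRing R]
  {arcs : E → Finset (V × V)} {s : V} {U : Finset V} {r : V} {c' : V → E} {a' : V}
  {ent : Finset V} {c : V → E} {a w : V}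

/-- **THE CHAIN WITH A SINGLE `a'`-ENTRY.** `a'` a one-entry OR-tail of the log-supermodular core
`U` (entry `r`, any coin), `a` an OR-tail of `insert a' U` (entries `ent ⊆ insert a' U` — `a'`
among them is the chain arc `a' → a` — any coins), markers in `insert a' U`, any head ⟹ row
2′DARC at `a → w`. -/
theorem darc_of_orTailK_oneChain (pr : E → R) (hp : IsProbVec pr) (hS : SameEnds arcs)
    (h' : OrTailK arcs s U {r} c' a') (h : OrTailK arcs s (insert a' U) ent c a)
    {m₁ m₂ : V} (hm₁ : m₁ ∈ insert a' U) (hm₂ : m₂ ∈ insert a' U)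
    (hν : ∀ W W', W ⊆ U → W' ⊆ U →
      prob pr (coreLevel arcs s U W) * prob pr (coreLevel arcs s U W') ≤
        prob pr (coreLevel arcs s U (W ∩ W')) * prob pr (coreLevel arcs s U (W ∪ W')))
    {t : V} (htC : t ∉ insert a (insert a' U)) (hts : t ≠ s) (hws : w ≠ s)
    (hwC : w ∉ insert a (insert a' U)) :
    DARC pr arcs s {t} m₁ m₂ a w :=
  darc_of_orTailK_coins_any pr hp hS h hm₁ hm₂ (h'.coreLevel_lsm_insert pr hp hν) htC hts hws hwC

end OneChain

end Summit.Ventures.PercRepro2.Coin
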